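import Summits.ResolutionOfSingularities.ResolutionOfSingularities.Theorems.StallVertexNullClasses
import Summits.ResolutionOfSingularities.ResolutionOfSingularities.Theorems.MaxContactCutStallVertexEvents
import HarnessLib

/-!
# MaxContactCutStallVertexFlat — decomp-res node «StallVertex» (lens-5 g22 rev 7/8), add-on tree file 22 of the node

Content VERBATIM from the decomp-res lens-5 file `HOME/decomp-res-lens-5/g22/StallVertex.lean` rev 8 (pin 9799ca34,
4 539 l; rev 8 = rev 7 25c16fe6 +
five pure insertions §1j/§1k/§2d/§3i/§4i/§4j; rev 7 = pure insertions §2c/§4h over the landed rev-6 content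
95ed6f6f — all earlier statements
byte-identical (critic machine diffs, CRITIC-LEDGER rows 142g / 142h); HOME = run/shared/lean/pub/decomp-res).  The
rev-0…6 sections are ALREADY in the
tree (`StallVertexForms` / `Kernels` / `Walk` / `Classes` / `Clean` / `Rigid` / `Lines` / `RigidClasses` / `Carry` /
`OldLetter` / `LineTurn` /
`LetterClasses` / `Regime` / `StraightClasses` + wiring `MaxContactCutStallVertex` /
`MaxContactCutStallVertexEvents`, writer g7/g8); the rev-7/8 add-on
files carry ONLY the 53 declarations NEW in rev 7 / rev 8.  Critic: CRITIC-LEDGER row 142g (rev 7, DECIDED +1 (Y):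
THE DEFICIENCY LAW — the positive
young-monomial regime is EMPTY, positive differential shade is an interference phenomenon, exact re-location
`monomialRegime_iff_flat`; inhabitants
T-regime 3 353/116; 2026-08-30T23:43:05Z) and row 142h (rev 8, BOOKED 0: RESONANCE / ECHO / NULL / COINCIDENCE laws
+ the exact two-leaf split
`defectWalksDeep_iff_positive_nullFlat`; 2026-08-31T00:03:14Z) — landing orders INBOX :525 / :543.  Landed by
decomp-res writer g9 as
`StallVertexEcho` (§1j + §1k + §3i), `StallVertexDeficiency` (§2c + §2d), `StallVertexDeficiencyLaw` (§4h
kernels: `FlatMonomialAt` … `muTilde_eq_zero_of_regime`),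
`StallVertexFlatClasses` (§4h cells and exact re-locations), `StallVertexNullClasses` (§4i + §4j cells and exact
re-locations) and the wiring file
`MaxContactCutStallVertexFlat` (every new `closes_…` / `defectWalksDeep_iff_…` BY NAME on
`MaxContactCut.DefectWalksDeep`).  All
`--supports stmt-ResolutionOfSingularities-31770`.  Every file of the node is in the Theses cone (the lens imports
the in-cone `DifferentialShade`), so the
located residual is booked on the route by RE-LOCATING the existing aside 28122 `CFNoSkewJointTailsDeep` (informal-only edit) to
`StallVertex.NoFlatRegimeSkewStalledTailsDeep` ≡ `NoPositiveSkewStalledTailsDeep ∧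
NoNullFlatSkewStalledTailsDeep` (EXACT, hypothesis-free chain
skew ↔ … ↔ monomialRegime ↔ flat ↔ positive ∧ nullFlat: `skew_iff_flat`, `skew_iff_positive_nullFlat`)
— one aside on this column (critic rows 142g/142h:
«file only the newest, exactly one aside on the column; decided cells and the μ̃-sign leaves NOT filed»).

THE WIRING of rev 7 / rev 8 VERBATIM, BY NAME on the MaxContactCut aside `DefectWalksDeep` 31770, in lens order: `closes_flat` /
**`defectWalksDeep_iff_flat : MaxContactCut.DefectWalksDeep ↔ NoFreePointTailsDeep ∧
CoefficientCut.NoPlanarJointTailsDeep ∧ NoFlatRegimeSkewStalledTailsDeep`**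
(§4h, EXACT), `closes_positive_nullFlat` / **`defectWalksDeep_iff_positive_nullFlat`** (§4j, EXACT two-leaf form).
 Imports `StallVertexNullClasses` and the
landed wiring `MaxContactCutStallVertexEvents` (`defectWalksDeep_iff_monomialRegime`).  Supports 31770.

[WRITER NOTE (decomp-res writer g9): file split only; namespace, opens, section variables and every declaration
exactly as in the lens (global `set_option` dropped; the lens's `set_option maxHeartbeats … in` lines kept; the
lens's private copy `flat_monomial'` of the landed
`Literature.AlgebraicGeometry.Resolution.PointBlowup.flat_monomial` is cited by its full name, as in `StallVertexCarry`).]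

(Sources: KawanoueMatsuki2016 Prop. 4 (2), §4.1; Kawanoue2007 Lemma 2.2.1.2; BierstoneGrigorievMilmanWlodarczyk2011
Def. 3.1.3; Hauser2010; HauserPerlega2024; Moh1987; CossartPiltant2008; Giraud1975; Hironaka1964; ZariskiSamuelII Ch. VIII §2.)
-/

noncomputable section

open MvPolynomial Finset
open Literature.AlgebraicGeometry.Resolution
open Literature.AlgebraicGeometry.Resolution.Hauser2010
open Literature.AlgebraicGeometry.Resolution.HauserPerlega2024
open Literature.Barriers.ResolutionOfSingularities
open Literature.AlgebraicGeometry.Resolution.PointBlowup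
open Summit.ResolutionOfSingularities.ResolutionOfSingularities.Theses
open Summit.ResolutionOfSingularities.ResolutionOfSingularities.Theorems.TightDefectClasses
open Summit.ResolutionOfSingularities.ResolutionOfSingularities.Theorems.ProximityCut
open Summit.ResolutionOfSingularities.ResolutionOfSingularities.Theorems.ExitLaw
open Summit.ResolutionOfSingularities.ResolutionOfSingularities.Theorems.DifferentialShade

namespace Summit.ResolutionOfSingularities.ResolutionOfSingularities.Theorems.StallVertex

section Classes

/-- `closes` from the flat-regime residual, BY NAME. [folklore] -/
theorem closes_flat (hA : NoFreePointTailsDeep) (hP : CoefficientCut.NoPlanarJointTailsDeep)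
    (hF : NoFlatRegimeSkewStalledTailsDeep) : MaxContactCut.DefectWalksDeep :=
  closes_monomialRegime hA hP (monomialRegime_of_flat hF)

/-- EXACT: `DefectWalksDeep ↔ (free-point) ∧ (planar) ∧ (interference-or-flat-regime skew stalled)`. [folklore] -/
theorem defectWalksDeep_iff_flat :
    MaxContactCut.DefectWalksDeep ↔
      NoFreePointTailsDeep ∧ CoefficientCut.NoPlanarJointTailsDeep ∧ NoFlatRegimeSkewStalledTailsDeep := by
  rw [defectWalksDeep_iff_monomialRegime, monomialRegime_iff_flat]

/-- `closes_positive_nullFlat`: Auxiliary step of this node's calculus, VERBATIM from the lens file (see the module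
docstring); the statement is its type. [folklore] -/
theorem closes_positive_nullFlat (hA : NoFreePointTailsDeep) (hP : CoefficientCut.NoPlanarJointTailsDeep)
    (hI : NoPositiveSkewStalledTailsDeep) (hZ : NoNullFlatSkewStalledTailsDeep) : MaxContactCut.DefectWalksDeep :=
  closes_flat hA hP ((flat_iff_positiveInterference_null.trans
    (Iff.and positiveInterference_iff_positive null_iff_nullFlat)).mpr ⟨hI, hZ⟩)

/-- `defectWalksDeep_iff_positive_nullFlat`: Auxiliary step of this node's calculus, VERBATIM from the lens file
(see the module docstring); the statement is its type. [folklore] -/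
theorem defectWalksDeep_iff_positive_nullFlat :
    MaxContactCut.DefectWalksDeep ↔
      NoFreePointTailsDeep ∧ CoefficientCut.NoPlanarJointTailsDeep ∧
        NoPositiveSkewStalledTailsDeep ∧ NoNullFlatSkewStalledTailsDeep := by
  rw [defectWalksDeep_iff_flat, flat_iff_positiveInterference_null, positiveInterference_iff_positive,
    null_iff_nullFlat]

end Classes

end Summit.ResolutionOfSingularities.ResolutionOfSingularities.Theorems.StallVertex
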